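/-
Copyright (c) 2026 the pub-hodgecm-mathlib formalisation cell (harness21).  Prover seat hodgecm-mathlib-F0P2-p01 (g13), 2026-09-01.  Road «S3-tree», organ «ORDER-STABILITY»
(the A-50 glue between ★ C1 `UnitaryLatticeTreeLevelShift` and the torus ∕ Cayley reading of the shifted element): stability of a lattice under a matrix is stability under its order.
-/
import Literature.NumberTheory.Automorphic.UnitaryLatticeTreeLevelShift   -- ★ p845386 (this seat): C1 `setOf_levelFixed_vertex_eq_setOf_levelShift_stable`, `mapGL_eq_and_level_iff_map_levelShift_le`; ⊇ ★ T1a∕T1b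
import Mathlib.RingTheory.Adjoin.Basic
import HarnessLib

/-!
# The lattice graph of a hermitian space — ORDER-STABILITY: a lattice stable under `X` is stable under the order `𝒪[X]`; with a unit `u` generating the same order,
# the level-`c` fixed vertices of `γ` are the vertices FIXED by `u` (road «S3-tree», A-50 reading of law C1; Kottwitz 1986 §3, Serre *Trees* II.1.1)

Topic `NumberTheory/Automorphic`; namespace `Literature.NumberTheory.Automorphic.UnitaryLatticeTree` (T1a currency ★ p845270: `[Valued K ℤᵐ⁰]`, `latt`, `mapGL`, `scaleLattice`,
`IsVertexLattice σ ϖ H d`).  THEOREMS ONLY (no definition, no instance, no notation, no named fact, no `sorry`); any `N`, any valued field, zero `U(2,1)`-specific content.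
Cell `pub/hodgecm-mathlib` (D-0151), crux H413 = `stmt-HodgeConjecture-24833`; road «S3-tree» (LEAD F0P3a-plan (g11), architect A-p16 (g29) A-49∕A-50∕A-59 (1); T3′ holder
F0P3b-p01 (g11)'s CAYLEY NOTE 2026-09-01T16:23:38Z: with `z = (γ−1)(γ+1)⁻¹` and `Y = (1 + z∕ϖ)(1 − z∕ϖ)⁻¹` one has `𝒪[(γ−1)∕ϖ] = 𝒪[Y]` with `Y` UNITARY in the same torus and all root
valuations lowered by one).  Seat F0P2-p01 (g13).  HONEST LABEL: HC_CM is proved only modulo the 2 remaining named inputs (hLiu418 24832, h413 24833) until rung 0 closes; nothing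
printed is asserted here — this is module algebra over a valuation ring; S3 stays a print row until the road's END lands.

THE MATHEMATICS.  For a lattice `M ⊆ K^N` (an `𝒪`-submodule) and a matrix `X`, `X·M ⊆ M` implies `Y·M ⊆ M` for every `Y` in the `𝒪`-subalgebra `𝒪[X] = Algebra.adjoin 𝒪 {X}`
of `M_N(K)` (§1; induction over `adjoin`: scalars, sums, products).  Hence stability depends only on the ORDER generated (§1 `…_iff_of_adjoin_eq`), and if a unit `u ∈ GL_N(K)` has
`u, u⁻¹ ∈ 𝒪[X]` and `X ∈ 𝒪[u]`, then `X·M ⊆ M ↔ u·M = M` (§2).  Plugged into ★ law C1 (`UnitaryLatticeTreeLevelShift` §5, `X = γ^{(c)} = 1 + c⁻¹(γ − 1)`): the level-`c`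
fixed vertices of `γ` of each type `d` ARE the vertices fixed by `u` (§3) — `N_j(γ) = N_0(u)` as SETS, `u` the torus element of the Cayley note (its algebra — `𝒪[c⁻¹(γ−1)] = 𝒪[u]`,
unitarity, root valuations — is supplied by T3′∕T5 as the three membership hypotheses; nothing about it is proved or assumed beyond them here).

* §1 `map_toLin'_le_of_mem_adjoin`, `map_toLin'_le_iff_of_adjoin_eq` — stability under `X` ⇒ under `𝒪[X]`; equal orders ⇒ same stable lattices.
* §2 `mapGL_eq_of_map_toLin'_le`, `map_toLin'_le_of_mapGL_eq`, `mapGL_eq_iff_map_toLin'_le` — a unit generating the same order: `X·M ⊆ M ↔ u·M = M`.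
* §3 `setOf_levelFixed_vertex_eq_setOf_fixed`, `ncard_levelFixed_vertex_eq_ncard_fixed` — C1 with a unitary right side: `{γ fixes M at level c} = {u·M = M}` on the vertices of type `d`.

## References
* [Kottwitz1986] R. E. Kottwitz, *Base change for unit elements of Hecke algebras*, Compositio Math. 60 (1986): §3 (fixed cosets ↔ lattices stable under an order).
* [Serre1980Trees] J.-P. Serre, *Trees* (1980): Ch. II §1.1–1.2.
* [Laumon1995] G. Laumon, *Cohomology of Drinfeld Modular Varieties* I (1996): Lemma (5.3.2) p. 136.
* [Rogawski1990] J. Rogawski, Ann. of Math. Stud. 123 (1990): §4.9 Prop. 4.9.1 (a) p. 55.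
-/

set_option autoImplicit false

noncomputable section

open scoped Valued WithZero Matrix MatrixGroups

namespace Literature.NumberTheory.Automorphic.UnitaryLatticeTree

open Literature.NumberTheory.Automorphic Literature.NumberTheory.Automorphic.HermitianLattice

variable {K : Type*} [Field K] [Valued K ℤᵐ⁰] {N : ℕ}

/-! ## §1 Stability under `X` is stability under the order `𝒪[X]` -/

/-- **A lattice stable under `X` is stable under every element of the order `𝒪[X] = Algebra.adjoin 𝒪 {X} ⊆ M_N(K)`.** [cite: Kottwitz1986, §3] [cite: Laumon1995, Lemma (5.3.2) p. 136] -/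
theorem map_toLin'_le_of_mem_adjoin (M : Submodule 𝒪[K] (Fin N → K)) {X Y : Matrix (Fin N) (Fin N) K}
    (hX : M.map ((Matrix.toLin' X).restrictScalars 𝒪[K]) ≤ M) (hY : Y ∈ Algebra.adjoin 𝒪[K] ({X} : Set (Matrix (Fin N) (Fin N) K))) :
    M.map ((Matrix.toLin' Y).restrictScalars 𝒪[K]) ≤ M := by
  -- pointwise form of stability
  have key : ∀ Z : Matrix (Fin N) (Fin N) K, M.map ((Matrix.toLin' Z).restrictScalars 𝒪[K]) ≤ M ↔ ∀ m ∈ M, Z.mulVec m ∈ M := by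
    intro Z
    constructor
    · intro h m hm
      exact h (Submodule.mem_map.2 ⟨m, hm, by rw [LinearMap.restrictScalars_apply, Matrix.toLin'_apply]⟩)
    · intro h x hx
      obtain ⟨m, hm, rfl⟩ := Submodule.mem_map.1 hx
      rw [LinearMap.restrictScalars_apply, Matrix.toLin'_apply]
      exact h m hm
  rw [key] at hX ⊢
  induction hY using Algebra.adjoin_induction with
  | mem Z hZ =>
      rw [Set.mem_singleton_iff] at hZ
      subst hZ
      exact hX
  | algebraMap r =>
      intro m hm
      rw [Algebra.algebraMap_eq_smul_one, Matrix.smul_mulVec, Matrix.one_mulVec]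
      exact M.smul_mem r hm
  | add Z W _ _ hZ hW =>
      intro m hm
      rw [Matrix.add_mulVec]
      exact M.add_mem (hZ m hm) (hW m hm)
  | mul Z W _ _ hZ hW =>
      intro m hm
      rw [← Matrix.mulVec_mulVec]
      exact hZ _ (hW m hm)

/-- **Equal orders have the same stable lattices**: `𝒪[X] = 𝒪[Y] ⇒ (X·M ⊆ M ↔ Y·M ⊆ M)`. [cite: Kottwitz1986, §3] -/
theorem map_toLin'_le_iff_of_adjoin_eq (M : Submodule 𝒪[K] (Fin N → K)) {X Y : Matrix (Fin N) (Fin N) K}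
    (h : Algebra.adjoin 𝒪[K] ({X} : Set (Matrix (Fin N) (Fin N) K)) = Algebra.adjoin 𝒪[K] ({Y} : Set (Matrix (Fin N) (Fin N) K))) :
    M.map ((Matrix.toLin' X).restrictScalars 𝒪[K]) ≤ M ↔ M.map ((Matrix.toLin' Y).restrictScalars 𝒪[K]) ≤ M :=
  ⟨fun hX => map_toLin'_le_of_mem_adjoin M hX (h ▸ Algebra.self_mem_adjoin_singleton 𝒪[K] Y),
    fun hY => map_toLin'_le_of_mem_adjoin M hY (h.symm ▸ Algebra.self_mem_adjoin_singleton 𝒪[K] X)⟩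

/-! ## §2 A unit generating the same order: stability ↔ being fixed -/

/-- **`X·M ⊆ M` ⇒ `u·M = M`** for a unit `u ∈ GL_N(K)` with `u, u⁻¹ ∈ 𝒪[X]`. [cite: Kottwitz1986, §3] [cite: Serre1980Trees, Ch. II §1.1] -/
theorem mapGL_eq_of_map_toLin'_le (M : Submodule 𝒪[K] (Fin N → K)) {X : Matrix (Fin N) (Fin N) K} (u : GL (Fin N) K)
    (hu : (u : Matrix (Fin N) (Fin N) K) ∈ Algebra.adjoin 𝒪[K] ({X} : Set (Matrix (Fin N) (Fin N) K)))
    (hu' : ((u⁻¹ : GL (Fin N) K) : Matrix (Fin N) (Fin N) K) ∈ Algebra.adjoin 𝒪[K] ({X} : Set (Matrix (Fin N) (Fin N) K)))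
    (hX : M.map ((Matrix.toLin' X).restrictScalars 𝒪[K]) ≤ M) : mapGL u M = M := by
  refine le_antisymm (map_toLin'_le_of_mem_adjoin M hX hu) ?_
  intro m hm
  have h1 : ((Matrix.toLin' ((u⁻¹ : GL (Fin N) K) : Matrix (Fin N) (Fin N) K)).restrictScalars 𝒪[K]) m ∈ M :=
    map_toLin'_le_of_mem_adjoin M hX hu' (Submodule.mem_map.2 ⟨m, hm, rfl⟩)
  refine Submodule.mem_map.2 ⟨_, h1, ?_⟩
  rw [LinearMap.restrictScalars_apply, LinearMap.restrictScalars_apply, Matrix.toLin'_apply, Matrix.toLin'_apply, Matrix.mulVec_mulVec,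
    ← Units.val_mul, mul_inv_cancel, Units.val_one, Matrix.one_mulVec]

/-- **`u·M = M` ⇒ `X·M ⊆ M`** for `X ∈ 𝒪[u]`. [cite: Kottwitz1986, §3] -/
theorem map_toLin'_le_of_mapGL_eq (M : Submodule 𝒪[K] (Fin N → K)) {X : Matrix (Fin N) (Fin N) K} (u : GL (Fin N) K)
    (hX : X ∈ Algebra.adjoin 𝒪[K] ({(u : Matrix (Fin N) (Fin N) K)} : Set (Matrix (Fin N) (Fin N) K))) (h : mapGL u M = M) :
    M.map ((Matrix.toLin' X).restrictScalars 𝒪[K]) ≤ M :=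
  map_toLin'_le_of_mem_adjoin M (X := (u : Matrix (Fin N) (Fin N) K)) h.le hX

/-- **Stability under `X` ↔ fixed by `u`**, for a unit `u` with `u, u⁻¹ ∈ 𝒪[X]` and `X ∈ 𝒪[u]` (e.g. the Cayley transform `u = Y` of T3′'s note, `X = c⁻¹(γ − 1)` or
`X = γ^{(c)}`). [cite: Kottwitz1986, §3] [cite: Serre1980Trees, Ch. II §1.1] -/
theorem mapGL_eq_iff_map_toLin'_le (M : Submodule 𝒪[K] (Fin N → K)) {X : Matrix (Fin N) (Fin N) K} (u : GL (Fin N) K)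
    (hu : (u : Matrix (Fin N) (Fin N) K) ∈ Algebra.adjoin 𝒪[K] ({X} : Set (Matrix (Fin N) (Fin N) K)))
    (hu' : ((u⁻¹ : GL (Fin N) K) : Matrix (Fin N) (Fin N) K) ∈ Algebra.adjoin 𝒪[K] ({X} : Set (Matrix (Fin N) (Fin N) K)))
    (hX : X ∈ Algebra.adjoin 𝒪[K] ({(u : Matrix (Fin N) (Fin N) K)} : Set (Matrix (Fin N) (Fin N) K))) :
    mapGL u M = M ↔ M.map ((Matrix.toLin' X).restrictScalars 𝒪[K]) ≤ M :=
  ⟨map_toLin'_le_of_mapGL_eq M u hX, mapGL_eq_of_map_toLin'_le M u hu hu'⟩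

/-! ## §3 Law C1 with a unitary right side: the level-`c` fixed vertices of `γ` are the vertices fixed by `u` -/

/-- **C1, FIXED-VERTEX FORM**: for `0 < |c| < 1`, `γ ∈ GL_N(K)`, and a unit `u` with `u, u⁻¹ ∈ 𝒪[γ^{(c)}]` and `γ^{(c)} ∈ 𝒪[u]` (`γ^{(c)} = 1 + c⁻¹(γ − 1)`; the Cayley element of
the shifted order, T3′'s note), on the vertices of every type `d`: `{M | γ·M = M ∧ (γ − 1)·M ⊆ c·M} = {M | u·M = M}` — i.e. `N_j(γ) = N_0(u)` as SETS (with `c = ϖ^j`), the right side a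
genuine fixed-vertex set of the graph automorphism of `u` when `u ∈ U(H)` (★ `latticeGraphIso`). [cite: Kottwitz1986, §3] [cite: Rogawski1990, §4.9 Prop. 4.9.1 (a) p. 55] -/
theorem setOf_levelFixed_vertex_eq_setOf_fixed (σ : K →+* K) (ϖ : K) (H : Matrix (Fin N) (Fin N) K) (d : ℕ)
    {c : K} (hc : c ≠ 0) (hc1 : Valued.v c < 1) (γ u : GL (Fin N) K)
    (hu : (u : Matrix (Fin N) (Fin N) K) ∈ Algebra.adjoin 𝒪[K] ({1 + c⁻¹ • ((γ : Matrix (Fin N) (Fin N) K) - 1)} : Set (Matrix (Fin N) (Fin N) K)))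
    (hu' : ((u⁻¹ : GL (Fin N) K) : Matrix (Fin N) (Fin N) K) ∈ Algebra.adjoin 𝒪[K] ({1 + c⁻¹ • ((γ : Matrix (Fin N) (Fin N) K) - 1)} : Set (Matrix (Fin N) (Fin N) K)))
    (hX : (1 + c⁻¹ • ((γ : Matrix (Fin N) (Fin N) K) - 1)) ∈ Algebra.adjoin 𝒪[K] ({(u : Matrix (Fin N) (Fin N) K)} : Set (Matrix (Fin N) (Fin N) K))) :
    {M : Submodule 𝒪[K] (Fin N → K) | IsVertexLattice σ ϖ H d M ∧ mapGL γ M = M ∧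
        M.map ((Matrix.toLin' ((γ : Matrix (Fin N) (Fin N) K) - 1)).restrictScalars 𝒪[K]) ≤ scaleLattice c M} =
      {M : Submodule 𝒪[K] (Fin N → K) | IsVertexLattice σ ϖ H d M ∧ mapGL u M = M} := by
  rw [setOf_levelFixed_vertex_eq_setOf_levelShift_stable σ ϖ H d hc hc1 γ]
  ext M
  simp only [Set.mem_setOf_eq]
  exact and_congr_right fun _ => (mapGL_eq_iff_map_toLin'_le M u hu hu' hX).symm

/-- **C1, FIXED-VERTEX COUNT** `N_j(γ) = N_0(u)`: same hypotheses, `Set.ncard` of both sides. [cite: Kottwitz1986, §3] [cite: Rogawski1990, §4.9 Prop. 4.9.1 (a) p. 55] -/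
theorem ncard_levelFixed_vertex_eq_ncard_fixed (σ : K →+* K) (ϖ : K) (H : Matrix (Fin N) (Fin N) K) (d : ℕ)
    {c : K} (hc : c ≠ 0) (hc1 : Valued.v c < 1) (γ u : GL (Fin N) K)
    (hu : (u : Matrix (Fin N) (Fin N) K) ∈ Algebra.adjoin 𝒪[K] ({1 + c⁻¹ • ((γ : Matrix (Fin N) (Fin N) K) - 1)} : Set (Matrix (Fin N) (Fin N) K)))
    (hu' : ((u⁻¹ : GL (Fin N) K) : Matrix (Fin N) (Fin N) K) ∈ Algebra.adjoin 𝒪[K] ({1 + c⁻¹ • ((γ : Matrix (Fin N) (Fin N) K) - 1)} : Set (Matrix (Fin N) (Fin N) K)))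
    (hX : (1 + c⁻¹ • ((γ : Matrix (Fin N) (Fin N) K) - 1)) ∈ Algebra.adjoin 𝒪[K] ({(u : Matrix (Fin N) (Fin N) K)} : Set (Matrix (Fin N) (Fin N) K))) :
    {M : Submodule 𝒪[K] (Fin N → K) | IsVertexLattice σ ϖ H d M ∧ mapGL γ M = M ∧
        M.map ((Matrix.toLin' ((γ : Matrix (Fin N) (Fin N) K) - 1)).restrictScalars 𝒪[K]) ≤ scaleLattice c M}.ncard =
      {M : Submodule 𝒪[K] (Fin N → K) | IsVertexLattice σ ϖ H d M ∧ mapGL u M = M}.ncard := by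
  rw [setOf_levelFixed_vertex_eq_setOf_fixed σ ϖ H d hc hc1 γ u hu hu' hX]

end Literature.NumberTheory.Automorphic.UnitaryLatticeTree

end
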